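import Summits.Ventures.Crystal3D.Theorems.StickyWulffConstantGenericWallFloorBarlowEndsPay
import HarnessLib

/-!
# The clamped Barlow plate is COMPLETE around its deep sites, and deep zigzag prefixes stay deep (F4, G-side: the `hR` / `hRin`
# inputs of the window lemmas, discharged from the cell hypotheses of `BilayerWallAt`)
# (crux `GenericWallFloor`, stmt-Ventures-19480, line `WallLedgerG`; lane T's F4, cf-p1 §86(58) BA)

HONEST FRAMING. Venture `Summits/Ventures/Crystal3D` (cell `crystal3d-full`), helper `--supports` the crux `GenericWallFloor`
(stmt-Ventures-19480) of `route-Ventures-StickyWulffConstant`, registered line `WallLedgerG`, open stub `stub_twoSlabAdhesion`.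
Rung credit only; F-C1 not moved; NOT the stub.

In the cell of `BilayerWallAt` the bottom plate is `P₁ = {p ∈ stacking L₁ s₁ σ₁ : −2R₀ ≤ p₂ ≤ −R₀, p₀² + p₁² ≤ ρ²} ⊆ X`.  The window
lemmas (`walkRun_canon_prefix`, `windowFamily_walkRun_injOn`, `windowStart_end_height_gt`, `canon_start_valid`) take a region `R` of
MODEL space with `hR : ∀ site ∈ R, ∀ q ∈ barlowStacking σ₁, dist q site ≤ 1 → L₁ q + s₁ ∈ X` and a closure property `hRin`.  Here:

* **`barlowWindow_complete`** — `hR` holds for the DEEP region `R = {p : −2R₀+1 ≤ (L₁p+s₁)₂ ≤ −R₀−1, (L₁p+s₁)₀² + (L₁p+s₁)₁² ≤ (ρ−1)²}`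
  (a stacking site within distance `1` of a deep site is a plate ball: stacking membership, height within `±1`, lateral radius `+1`);
* **`barlowWindow_hRin`** — a model point whose moved image has height in `[H, Ztop] ⊆ [−2R₀+1, −R₀−1]` and which lies within `D` of a
  start of lateral radius `≤ ρ_T` with `ρ_T + D ≤ ρ − 1` belongs to that `R` (heights as `⟪·, e₃⟫`, the window lemmas' currency).
WHAT THIS IS NOT: not F4; F-C1 not moved.
-/

noncomputable section

namespace Summit.Ventures.Crystal3D.Theorems

open Finset
open Literature.MathematicalPhysics.StatisticalMechanics
open Summit.Ventures.Crystal3D.Cruxes.TextureLiminf.TexShadow (stacking)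
open scoped InnerProductSpace

variable {X : Finset (EuclideanSpace ℝ (Fin 3))}

/-- `⟪d, e₃⟫ = d₂`. -/
private theorem inner_e₃_eq_apply_two (d : EuclideanSpace ℝ (Fin 3)) :
    ⟪d, EuclideanSpace.single (2 : Fin 3) (1 : ℝ)⟫_ℝ = d 2 := by
  rw [EuclideanSpace.inner_single_right]; simp

/-- A rigid motion preserves distances between sites. -/
private theorem dist_moved (L : EuclideanSpace ℝ (Fin 3) ≃ₗᵢ[ℝ] EuclideanSpace ℝ (Fin 3)) (s p q : EuclideanSpace ℝ (Fin 3)) :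
    dist (L q + s) (L p + s) = dist q p := by
  rw [dist_eq_norm, dist_eq_norm, show L q + s - (L p + s) = L q - L p by abel, ← map_sub, LinearIsometryEquiv.norm_map]

/-- The third coordinates of two points differ by at most their distance. -/
private theorem abs_apply_two_sub_le_dist (y x : EuclideanSpace ℝ (Fin 3)) : |y 2 - x 2| ≤ dist y x := by
  have h := dist_sq_eq_three y x
  have h1 : (y 2 - x 2) ^ 2 ≤ dist y x ^ 2 := by nlinarith [sq_nonneg (y 0 - x 0), sq_nonneg (y 1 - x 1)]
  exact abs_le_of_sq_le_sq h1 dist_nonneg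

/-- **The clamped plate is complete around its deep sites.**  Cell: `P₁ ⊆ X`, `P₁ = stacking ∩ [−2R₀, −R₀] × {lat ≤ ρ}`, `ρ ≥ 1`.
For a model site `p = barlowPos σ₁ m i j` whose moved image is DEEP (`−2R₀+1 ≤ (L₁p+s₁)₂ ≤ −R₀−1`, lateral `≤ (ρ−1)²`), every
stacking site within distance `1` of `p` is, after the motion, a ball of `X`. -/
theorem barlowWindow_complete {σ₁ : ℤ → ℤ} (L₁ : EuclideanSpace ℝ (Fin 3) ≃ₗᵢ[ℝ] EuclideanSpace ℝ (Fin 3))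
    (s₁ : EuclideanSpace ℝ (Fin 3)) (R₀ ρ : ℝ) (hρ : 1 ≤ ρ) (P₁ : Finset (EuclideanSpace ℝ (Fin 3))) (hP₁X : P₁ ⊆ X)
    (hP₁ : ∀ p, p ∈ P₁ ↔ (p ∈ stacking L₁ s₁ σ₁ ∧ -(2 * R₀) ≤ p 2 ∧ p 2 ≤ -R₀ ∧ p 0 ^ 2 + p 1 ^ 2 ≤ ρ ^ 2))
    (m i j : ℤ)
    (hlo : -(2 * R₀) + 1 ≤ (L₁ (barlowPos 1 (Real.sqrt (2 / 3)) σ₁ m i j) + s₁) 2)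
    (hhi : (L₁ (barlowPos 1 (Real.sqrt (2 / 3)) σ₁ m i j) + s₁) 2 ≤ -R₀ - 1)
    (hlat : (L₁ (barlowPos 1 (Real.sqrt (2 / 3)) σ₁ m i j) + s₁) 0 ^ 2 + (L₁ (barlowPos 1 (Real.sqrt (2 / 3)) σ₁ m i j) + s₁) 1 ^ 2 ≤
      (ρ - 1) ^ 2) :
    ∀ q ∈ barlowStacking 1 (Real.sqrt (2 / 3)) σ₁, dist q (barlowPos 1 (Real.sqrt (2 / 3)) σ₁ m i j) ≤ 1 → L₁ q + s₁ ∈ X := by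
  intro q hq hd
  set x := L₁ (barlowPos 1 (Real.sqrt (2 / 3)) σ₁ m i j) + s₁ with hx
  set y := L₁ q + s₁ with hy
  have hdist : dist y x ≤ 1 := by rw [hy, hx, dist_moved]; exact hd
  have h2 := abs_apply_two_sub_le_dist y x
  obtain ⟨h2a, h2b⟩ := abs_le.1 (h2.trans hdist)
  have hlat' : y 0 ^ 2 + y 1 ^ 2 ≤ ρ ^ 2 := by
    have := lateral_sq_le_of_dist_le_one (y := y) (q := x) (r := ρ - 1) (by linarith) hlat hdist
    simpa using this
  refine hP₁X ((hP₁ y).2 ⟨⟨q, hq, rfl⟩, by linarith, by linarith, hlat'⟩)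

/-- **Deep prefixes stay in the deep region.**  If `H ≥ −2R₀+1`, `Ztop ≤ −R₀−1`, the start `p` has lateral radius `≤ ρ_T`, and
`ρ_T + D ≤ ρ − 1`, then every model point `p′` with `H ≤ ⟪L₁p′+s₁, e₃⟫ ≤ Ztop` and `‖p′ − p‖ ≤ D` is deep
(`−2R₀+1 ≤ (L₁p′+s₁)₂ ≤ −R₀−1`, lateral `≤ (ρ−1)²`; `ρ ≥ 1 + ρ_T + D` makes `ρ − 1 ≥ 0` automatic). -/
theorem barlowWindow_hRin (L₁ : EuclideanSpace ℝ (Fin 3) ≃ₗᵢ[ℝ] EuclideanSpace ℝ (Fin 3)) (s₁ : EuclideanSpace ℝ (Fin 3))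
    (R₀ ρ ρT D H Ztop : ℝ) (hH : -(2 * R₀) + 1 ≤ H) (hZ : Ztop ≤ -R₀ - 1) (hsum : ρT + D ≤ ρ - 1)
    (p p' : EuclideanSpace ℝ (Fin 3))
    (hp : Real.sqrt ((L₁ p + s₁) 0 ^ 2 + (L₁ p + s₁) 1 ^ 2) ≤ ρT)
    (h1 : H ≤ ⟪L₁ p' + s₁, EuclideanSpace.single (2 : Fin 3) (1 : ℝ)⟫_ℝ)
    (h2 : ⟪L₁ p' + s₁, EuclideanSpace.single (2 : Fin 3) (1 : ℝ)⟫_ℝ ≤ Ztop) (h3 : ‖p' - p‖ ≤ D) :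
    -(2 * R₀) + 1 ≤ (L₁ p' + s₁) 2 ∧ (L₁ p' + s₁) 2 ≤ -R₀ - 1 ∧ (L₁ p' + s₁) 0 ^ 2 + (L₁ p' + s₁) 1 ^ 2 ≤ (ρ - 1) ^ 2 := by
  rw [inner_e₃_eq_apply_two] at h1 h2
  refine ⟨by linarith, by linarith, ?_⟩
  have hd : dist (L₁ p' + s₁) (L₁ p + s₁) ≤ D := by rw [dist_moved, dist_eq_norm]; exact h3
  have hr := lateral_radius_le_add_dist (L₁ p' + s₁) (L₁ p + s₁)
  have hr' : Real.sqrt ((L₁ p' + s₁) 0 ^ 2 + (L₁ p' + s₁) 1 ^ 2) ≤ ρ - 1 := by linarith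
  have h0 : 0 ≤ (L₁ p' + s₁) 0 ^ 2 + (L₁ p' + s₁) 1 ^ 2 := by positivity
  have h7 := pow_le_pow_left₀ (Real.sqrt_nonneg _) hr' 2
  rwa [Real.sq_sqrt h0] at h7

end Summit.Ventures.Crystal3D.Theorems

end
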